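import Mathlib.Tactic.Linarith
import Mathlib.Tactic.NormNum
import HarnessLib

/-!
# The (0,1) cell of the ι-window, XXXIX (companion B): the product ground `B₁ × B₂`, XXVI — THE CORNER XI, THEOREM LINE-CAP
# (report [XXXIX] `H2-ZERO-ONE-39.md` 4.5): arithmetic shadow of the P-section count on a line's own abelian surface

Family `hodge`, b2b cell `hweil` (helper of item stmt-HodgeConjecture-2524). Report
`run/shared/lean/b2b/hodge-weil/b2b-hweil-pv1-g51/H2-ZERO-ONE-39.md` ([XXXIX]) 4.5. Context (the report's words, nothing of them formalised here): for a
one-x̃-block S-line `Y_z ⊂ W′` of multiplicity `m` whose abelian surface `P_z = B₁ × {z}` contains no other component of `W′`, the residual section on `P_z`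
has `W′·f′ + 2ρν + 2ν²` zeros (`38` / `52` at `ρ = 4`, `W′·f′ = 28`, `ν = 1` / `2`) and contains the whole embedded part of `Y_z ∩ P_z`, of length
`ℓ_{m−1} = ε_{m−1} − 2m + 2 = 10 + c₀` (`ν = 1`) resp. `ε_{m−1} + ε_{m−2} − 4m + 8` (`ν = 2`, plain); with the superadditive lower bounds from `ε₂ ≥ 6 / 7 / 8`
or `ε₃ ≥ 8` this caps `m` at `42 / 66 / 22` (`ν = 1`) and `15 / 19 / 15` (`ν = 2`). The theorem below is the integer arithmetic. It claims no geometry.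
HONEST FRAMING: census work inside the ladder's H2 test ((0,1) cell) on the SPECIAL fourfold `X₀`; nothing here is a rung; no case of the Hodge conjecture
is proved; no statement of [Markman 2025] / [Perry 2026] / [EdGFS 2025] is used.
-/

-- mandated namespace `Summit.HodgeConjecture.HodgeConjecture.…` (Problem = Summit) trips `linter.dupNamespace`; the lakefile disables it
-- tree-wide (weak option), restated here so stand-alone elaboration is warning-free too.
set_option linter.dupNamespace false

namespace Summit.HodgeConjecture.HodgeConjecture.WeilTypeLadder

section ProductGroundTwentySixB

/-- **[XXXIX] 4.5 (THEOREM LINE-CAP).** `ν = 1`: `ε_{m−1} − 2m + 2 ≤ 38`, i.e. `c₀ ≤ 28` (`ε_{m−1} = 2m + 8 + c₀`); with `ε_{m−1} ≥ 6⌊(m−1)/2⌋` (`ε₂ ≥ 6`):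
`m ≤ 42`; with `ε_{m−1} ≥ 8⌊(m−1)/2⌋` (`ε₂ ≥ 8`, free pair): `m ≤ 22`; with `ε_{m−1} ≥ 8⌊(m−1)/3⌋` (`ε₃ ≥ 8`): `m ≤ 66`. `ν = 2`: `ε_{m−1} + ε_{m−2} − 4m + 8 ≤ 52`;
with `ε_{m−1} + ε_{m−2} ≥ 8(⌊(m−1)/2⌋ + ⌊(m−2)/2⌋) = 8(m − 2)`: `m ≤ 15`; with `7(m − 2)`: `m ≤ 19`. [`omega`] -/
theorem pg26b_line_cap :
    (∀ m εt c₀ : ℤ, εt = 2 * m + 8 + c₀ → εt - 2 * m + 2 ≤ 38 → c₀ ≤ 28) ∧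
    (∀ m εt : ℤ, 3 ≤ m → 6 * ((m - 1) / 2) ≤ εt → εt - 2 * m + 2 ≤ 38 → m ≤ 42) ∧
    (∀ m εt : ℤ, 3 ≤ m → 8 * ((m - 1) / 2) ≤ εt → εt - 2 * m + 2 ≤ 38 → m ≤ 22) ∧
    (∀ m εt : ℤ, 3 ≤ m → 8 * ((m - 1) / 3) ≤ εt → εt - 2 * m + 2 ≤ 38 → m ≤ 66) ∧
    (∀ m : ℤ, 2 ≤ m → (m - 1) / 2 + (m - 2) / 2 = m - 2) ∧
    (∀ m s : ℤ, 3 ≤ m → 8 * (m - 2) ≤ s → s - 4 * m + 8 ≤ 52 → m ≤ 15) ∧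
    (∀ m s : ℤ, 3 ≤ m → 7 * (m - 2) ≤ s → s - 4 * m + 8 ≤ 52 → m ≤ 19) ∧
    ((28 : ℤ) + 2 * 4 * 1 + 2 * 1 ^ 2 = 38 ∧ (28 : ℤ) + 2 * 4 * 2 + 2 * 2 ^ 2 = 52) := by
  refine ⟨fun m εt c₀ h1 h2 => by omega, fun m εt hm h1 h2 => by omega, fun m εt hm h1 h2 => by omega, fun m εt hm h1 h2 => by omega,
    fun m hm => by omega, fun m s hm h1 h2 => by omega, fun m s hm h1 h2 => by omega, by norm_num⟩

end ProductGroundTwentySixB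

end Summit.HodgeConjecture.HodgeConjecture.WeilTypeLadder
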